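import Literature.Analysis.FluidPDE.NSForcedLerayRate
import Literature.Analysis.FluidPDE.NSForcedLeraySupNorm
import Literature.Analysis.FluidPDE.ClayForceLerayProjection
import Literature.Analysis.FluidPDE.NSForcedEnstrophyOfSupNorm
import Literature.Analysis.FluidPDE.NSForcedH1ContinuationHolds
import HarnessLib

/-!
# Discharge of `lemarieRieusset2016_lerayRate_forced` (Leray's `L^q` blow-up rate, `3 < q < ∞`,
# for MAXIMAL classical solutions of the FORCED system with Clay data)

Analysis/FluidPDE proof file (cell `pub/ns-blowup`, seat `ns-blowup-ecbridge-7` g4; theorems only,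
no definitions, no named facts; net Literature debt −1). It proves the named fact
`lemarieRieusset2016_lerayRate_forced` of `NSForcedLerayRate.lean` — the LAST unproved Literature
input of the E–C lane of the route `PalasekTowerBreakdown` (consumers:
`Summits/NavierStokesRegularity/FluidComputer/DesignedBlowupSerrinDivergence.lean`,
`…/DesignedBlowupSubLerayRate.lean`, `Literature/…/NSForcedH1ContinuationOfLerayRate.lean`).
WHAT THIS IS NOT: not a statement about Navier–Stokes blow-up — a necessary condition that every
GIVEN maximal classical solution of the forced system satisfies at its maximal time.

**Statement** (Lemarié-Rieusset 2016, Thm. 11.4 with Thm. 7.2 / Leray 1934, (3.20); the dictionary is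
that of the def): for `ν > 0`, `3 < q < ∞` there is `C = C(ν, q) > 0` such that every maximal
classical solution `(u, p)` on `[0, T)` (`IsMaximalSmoothSolution ν f u p T`: classical on `[0, T)`, no
classical extension past `T`) with Tao-class velocity on closed sub-slabs, finite energy, Schwartz
datum and Clay-class force satisfies `liminf_{t → T⁻} (T - t)^{(1-3/q)/2} ‖u(t)‖_{L^q} ≥ C`.

**Proof** (the printed architecture — Lemarié-Rieusset p. 348: "if `T* < T_MAX`, `u` would be
bounded on `[0, T*]`, hence would satisfy `sup_{t<T*} ‖u‖_{H¹} < ∞`"; Ożański–Pooley 2018, Cor. 6.25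
for Leray's original route — with the force carried along):

1. *Short-time sup bound WITH force* (`leray_supnorm_le_of_Lp_forced`, `NSForcedLeraySupNorm.lean`;
   Leray §21–22 / Ożański–Pooley Lemma 6.23 (iii) via the forced Oseen representation
   `ForcedOseenRepresentation(Classical).lean`): a classical solution on a closed slab driven by a
   bounded, weakly divergence-free, square-integrable continuous force `g`, from a datum with
   `‖u(0)‖_q ≤ N`, obeys `|u(s, x)| ≤ 4N(νs)^{-3/(2q)}` for `s` in the window
   `s ≤ c ν^{(q+3)/(q-3)} (2N)^{-2q/(q-3)}` as long as the force is absorbed,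
   `s^{1+3/(2q)} ν^{3/(2q)} G ≤ N`.
2. *The force.* The momentum equation only sees `-∇p + f = -∇(p - p_f) + P f`: the solution is
   re-gauged to the Leray projection `P f = clayProjForce` of the Clay force on the slab `[0, T]`
   (`ClayForceLerayProjection.lean`, Tao 2013 (8)), which is jointly continuous, bounded (`G`), weakly
   divergence-free and uniformly `L²` (`G₂`) — uniformly on `[0, T]`, so that `G` is fixed before the
   liminf is tested (`IsClassicalNSSolutionOn.to_clayProjForce_of_subset`).
3. *The contradiction.* Put `C := ½ c^{b} ν^{(q+3)/(2q)}`, `b = (1-3/q)/2`. If at some `t₀` close to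
   `T` (`T - t₀ = δ ≤ δ₀(C, ν, G, T)`) one had `δ^b ‖u(t₀)‖_q < C`, then with `N := C δ^{-b}` the window
   from `t₀` is EXACTLY `δ` (`c ν^{(q+3)/(q-3)} (2N)^{-2q/(q-3)} = δ`, the exponent identity
   `b · 2q/(q-3) = 1`) and the force is absorbed on it (`δ^{3/2} ν^{3/(2q)} G ≤ C`, since
   `3/(2q) + b = 1/2`); step 1 on the translated slabs `[t₀, t₀ + S]`, `S < δ`, bounds `u` on
   `[t₀ + δ/2, T) × ℝ³` by `4N(νδ/2)^{-3/(2q)}`, and `u` is bounded on `[0, t₀ + δ/2] × ℝ³` by the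
   Sobolev bounds on that closed sub-slab (`linfty_bound_of_hasBoundedSobolevNormsOn_holds`). So the
   velocity is bounded up to `T`; by `exists_enstrophy_le_of_norm_le_forced`
   (`NSForcedEnstrophyOfSupNorm.lean`: the forced Serrin inequality at `r = ∞` on re-gauged pieces,
   Lemarié-Rieusset Thm. 11.2) the enstrophy is bounded up to `T`, and by the forced `H¹` blow-up
   alternative `lemarieRieusset2016_H1_continuation_forced_holds` (Thm. 7.2 with force) `u` extends
   classically past `T` — contradicting maximality. Hence `δ^b ‖u(t₀)‖_q ≥ C` for all `t₀ ∈ (T - δ₀, T)`,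
   and the liminf is `≥ C` (`Filter.le_liminf_of_le`).

## Mathlib / tree search

Tree: `leray_supnorm_le_of_Lp_forced`, `clayProjForce` + `exists_norm_clayProjForce_le` /
`exists_eLpNorm_two_clayProjForce_le` / `continuous_uncurry_clayProjForce` /
`isWeaklyDivFree_clayProjForce` / `clayProjForce_eq_sub_gradient_of_mem` /
`isSmoothSpaceTimeOn_forcePressure_forceData`, `IsClassicalNSSolutionOn.add_gradient`,
`ForcedEnstrophyOfSupNorm.exists_enstrophy_le_of_norm_le_forced`,
`lemarieRieusset2016_H1_continuation_forced_holds`, `linfty_bound_of_hasBoundedSobolevNormsOn_holds`,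
`IsSmoothOnHalfSpace.isSmoothSpaceTimeOn_Icc`, `HasRapidSpaceTimeDecay.hasUniformRapidDecayOn_Icc`.
The unforced twin is `leray_blowup_rate_holds` (`NSLerayBlowupRateHolds`).

## References

* P. G. Lemarié-Rieusset, *The Navier–Stokes Problem in the 21st Century*, CRC Press (2016),
  Thm. 11.4 (p. 348, PDF p. 327 of doi:10.1201/b19556) with Thm. 7.2 (p. 125) and Thm. 11.2 (11.11).
  [LemarieRieusset2016]
* J. Leray, *Sur le mouvement d'un liquide visqueux emplissant l'espace*, Acta Math. 63 (1934)
  193–248, (3.20) p. 227, §21–22. [Leray1934]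
* W. S. Ożański, B. C. Pooley, *Leray's fundamental work on the Navier–Stokes equations*,
  LMS Lecture Note Ser. 452 (2018) = arXiv:1708.09787, Lemma 6.23 (iii), Cor. 6.25. [OzanskiPooley2018]
* T. Tao, Anal. PDE 6 (2013) 25–107 = arXiv:1108.1165, (8) p. 3, Thm. 5.4. [Tao2011]
-/

noncomputable section

open MeasureTheory TopologicalSpace Set Function Filter
open _root_.Topology
open scoped ENNReal NNReal FourierTransform

namespace Literature.Analysis.FluidPDE

open FourierNS

namespace ForcedLerayRate

/-! ### Arithmetic of the window -/

/-- **The window is exactly `δ`.** With `b = (1 - 3/q)/2`, `C = ½ c^b ν^{(q+3)/(2q)}` and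
`N = C δ^{-b}`: `c ν^{(q+3)/(q-3)} (2N)^{-2q/(q-3)} = δ` (`b · 2q/(q-3) = 1`,
`(q+3)/(2q) · 2q/(q-3) = (q+3)/(q-3)`). [cite: LemarieRieusset2016, Thm. 11.4 (p. 348)] -/
theorem window_eq {c ν δ q : ℝ} (hc : 0 < c) (hν : 0 < ν) (hδ : 0 < δ) (hq : 3 < q) :
    c * ν ^ ((q + 3) / (q - 3)) *
        (2 * ((1 / 2 * c ^ ((1 - 3 / q) / 2) * ν ^ ((q + 3) / (2 * q))) * δ ^ (-((1 - 3 / q) / 2)))) ^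
          (-(2 * q / (q - 3))) = δ := by
  have hq0 : 0 < q := by linarith
  have hq3 : 0 < q - 3 := by linarith
  set b : ℝ := (1 - 3 / q) / 2 with hb
  set e : ℝ := 2 * q / (q - 3) with he
  have hbe : b * e = 1 := by rw [hb, he]; field_simp
  have hae : (q + 3) / (2 * q) * e = (q + 3) / (q - 3) := by rw [he]; field_simp
  have h2 : 2 * ((1 / 2 * c ^ b * ν ^ ((q + 3) / (2 * q))) * δ ^ (-b)) =
      c ^ b * ν ^ ((q + 3) / (2 * q)) * δ ^ (-b) := by ring
  rw [h2, Real.mul_rpow (by positivity) (Real.rpow_nonneg hδ.le _),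
    Real.mul_rpow (Real.rpow_nonneg hc.le _) (Real.rpow_nonneg hν.le _),
    ← Real.rpow_mul hc.le, ← Real.rpow_mul hν.le, ← Real.rpow_mul hδ.le,
    show b * -e = -1 by rw [mul_neg, hbe], show (q + 3) / (2 * q) * -e = -((q + 3) / (q - 3)) by
      rw [mul_neg, hae], show -b * -e = 1 by rw [neg_mul_neg, hbe], Real.rpow_one,
    Real.rpow_neg_one, Real.rpow_neg hν.le]
  have hνa : ν ^ ((q + 3) / (q - 3)) ≠ 0 := (Real.rpow_pos_of_pos hν _).ne'
  field_simp

/-- **Force absorption on the window.** With `β' = 3/(2q)`, `b = (1 - 3/q)/2` (so `β' + b = 1/2`):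
if `δ^{3/2} (ν^{β'} G) ≤ C` then `s^{1+β'} ν^{β'} G ≤ C δ^{-b}` for every `0 < s ≤ δ`. [cite: LemarieRieusset2016, Thm. 11.4 (p. 348)] -/
theorem absorb_le {ν δ s q C G : ℝ} (hν : 0 < ν) (hδ : 0 < δ) (hq : 3 < q) (hG : 0 ≤ G)
    (hs : s ∈ Ioc 0 δ) (hsmall : δ ^ (3 / 2 : ℝ) * (ν ^ (3 / (2 * q)) * G) ≤ C) :
    s ^ (1 + 3 / (2 * q)) * ν ^ (3 / (2 * q)) * G ≤ C * δ ^ (-((1 - 3 / q) / 2)) := by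
  have hq0 : 0 < q := by linarith
  have hexp : (1 : ℝ) + 3 / (2 * q) = 3 / 2 + -((1 - 3 / q) / 2) := by field_simp; ring
  have h1 : s ^ (1 + 3 / (2 * q)) ≤ δ ^ (1 + 3 / (2 * q)) :=
    Real.rpow_le_rpow hs.1.le hs.2 (by positivity)
  calc s ^ (1 + 3 / (2 * q)) * ν ^ (3 / (2 * q)) * G
      ≤ δ ^ (1 + 3 / (2 * q)) * ν ^ (3 / (2 * q)) * G := by gcongr
    _ = δ ^ (-((1 - 3 / q) / 2)) * (δ ^ (3 / 2 : ℝ) * (ν ^ (3 / (2 * q)) * G)) := by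
        rw [hexp, Real.rpow_add hδ]; ring
    _ ≤ δ ^ (-((1 - 3 / q) / 2)) * C :=
        mul_le_mul_of_nonneg_left hsmall (Real.rpow_nonneg hδ.le _)
    _ = C * δ ^ (-((1 - 3 / q) / 2)) := mul_comm _ _

/-- Reading an `L^q` bound off `(T - t)^b ‖u(t)‖_q < C` (in `ℝ≥0∞`): `‖u(t)‖_q ≤ C (T-t)^{-b}`. [folklore] -/
private theorem eLpNorm_le_of_mul_lt {X : ℝ≥0∞} {δ b C : ℝ} (hδ : 0 < δ)
    (h : ENNReal.ofReal (δ ^ b) * X < ENNReal.ofReal C) :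
    X ≤ ENNReal.ofReal (C * δ ^ (-b)) := by
  have hδb : 0 < δ ^ b := Real.rpow_pos_of_pos hδ _
  rw [Real.rpow_neg hδ.le, ← div_eq_mul_inv, ENNReal.ofReal_div_of_pos hδb]
  refine (ENNReal.le_div_iff_mul_le (Or.inl ((ENNReal.ofReal_pos.2 hδb).ne'))
    (Or.inl ENNReal.ofReal_ne_top)).2 ?_
  rw [mul_comm]
  exact h.le

end ForcedLerayRate

/-! ### The re-gauge to the projected force, on a sub-slab -/

section Regauge

variable {T : ℝ} {f : ℝ → EuclideanSpace ℝ (Fin 3) → EuclideanSpace ℝ (Fin 3)}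
  (hT : 0 < T) (hf : IsSmoothSpaceTimeOn (Icc 0 T) f) (hd : HasUniformRapidDecayOn (Icc 0 T) f)

/-- **The re-gauge `(u, p, f) ↦ (u, p - p_f, P f)` on a time set `S ⊆ [0, T]`** (the projector
`clayProjForce` being built on the slab `[0, T]`): a classical solution on `S × ℝ³` driven by `f`
is a classical solution on `S × ℝ³` driven by `P f` with the pressure `p - Δ⁻¹∇·f` (Tao 2013, (8);
the tree's `IsClassicalNSSolutionOn.to_clayProjForce` is the case `S = [0, T]`). [cite: Tao2011, (8) p. 3] -/
theorem IsClassicalNSSolutionOn.to_clayProjForce_of_subset {S : Set ℝ} (hS : S ⊆ Icc 0 T) {ν : ℝ}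
    {u : ℝ → EuclideanSpace ℝ (Fin 3) → EuclideanSpace ℝ (Fin 3)}
    {p : ℝ → EuclideanSpace ℝ (Fin 3) → ℝ} (h : IsClassicalNSSolutionOn S ν f u p) :
    IsClassicalNSSolutionOn S ν (clayProjForce hT hf hd) u
      (fun t x => p t x + (-1 : ℝ) • (𝓕 (forcePresSymbol (forceData hT hf hd t)) x).re) := by
  refine h.add_gradient
    (((isSmoothSpaceTimeOn_forcePressure_forceData hT hf hd).const_smul (-1)).mono hS)
    fun t ht x => ?_
  have ht' : t ∈ Icc 0 T := hS ht
  have hd1 : DifferentiableAt ℝ (fun y => (𝓕 (forcePresSymbol (forceData hT hf hd t)) y).re) x :=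
    (((isSmoothSpaceTimeOn_forcePressure_forceData hT hf hd).contDiff_slice ht').differentiable
      (by simp)).differentiableAt
  have hneg : gradient (fun y => (-1 : ℝ) • (𝓕 (forcePresSymbol (forceData hT hf hd t)) y).re) x =
      -gradient (fun y => (𝓕 (forcePresSymbol (forceData hT hf hd t)) y).re) x := by
    have hfun : (fun y => (-1 : ℝ) • (𝓕 (forcePresSymbol (forceData hT hf hd t)) y).re) =
        (-1 : ℝ) • fun y => (𝓕 (forcePresSymbol (forceData hT hf hd t)) y).re := rfl
    rw [gradient, gradient, hfun, fderiv_const_smul hd1 (-1 : ℝ), map_smul, neg_one_smul]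
  rw [hneg, clayProjForce_eq_sub_gradient_of_mem hT hf hd ht']
  abel

end Regauge

/-! ### The discharge -/

/-- **Leray's `L^q` blow-up rate WITH a Clay-class force — discharge of
`lemarieRieusset2016_lerayRate_forced`** (Lemarié-Rieusset 2016, Thm. 11.4 with Thm. 7.2 and
Thm. 11.2; Leray 1934, (3.20); Ożański–Pooley 2018, Cor. 6.25): for `ν > 0`, `3 < q < ∞` there is
`C > 0` (here `C = ½ c^{(1-3/q)/2} ν^{(q+3)/(2q)}`, `c = c(q)` the window constant of
`leray_supnorm_le_of_Lp_forced`) such that every maximal classical solution of the forced system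
with Tao-class velocity on closed sub-slabs, finite energy, Schwartz datum and Clay-class force has
`liminf_{t → T⁻} (T - t)^{(1-3/q)/2} ‖u(t)‖_{L^q} ≥ C`. Proof in the module docstring: below the
threshold the forced short-time sup bound from `t₀` covers `[t₀ + δ/2, T)`, the velocity is bounded
up to `T`, hence (forced Serrin inequality at `r = ∞` on re-gauged pieces) the enstrophy is bounded
up to `T`, hence (`lemarieRieusset2016_H1_continuation_forced_holds`) the solution extends past `T`,
contradicting maximality. [cite: LemarieRieusset2016, Thm. 11.4 (p. 327) with Thm. 7.2 (p. 125) and Thm. 11.2 (11.11)]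
[cite: Leray1934, (3.20) p. 227] [cite: OzanskiPooley2018, Cor. 6.25 with Lemma 6.23 (iii)] -/
theorem lemarieRieusset2016_lerayRate_forced_holds : lemarieRieusset2016_lerayRate_forced := by
  intro ν q hν hq
  obtain ⟨c, hc, hD1⟩ := leray_supnorm_le_of_Lp_forced hq
  have hq0 : 0 < q := by linarith
  refine ⟨1 / 2 * c ^ ((1 - 3 / q) / 2) * ν ^ ((q + 3) / (2 * q)), by positivity, ?_⟩
  intro T hT f u p hmax hTao hTao' hE hu₀ hfs hfd
  set b : ℝ := (1 - 3 / q) / 2 with hb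
  set C : ℝ := 1 / 2 * c ^ b * ν ^ ((q + 3) / (2 * q)) with hC
  have hCpos : 0 < C := by positivity
  -- ### the projected force on `[0, T]`: uniform constants `G`, `G₂`
  have hfT : IsSmoothSpaceTimeOn (Icc 0 T) f := hfs.isSmoothSpaceTimeOn_Icc T
  have hdT : HasUniformRapidDecayOn (Icc 0 T) f := hfd.hasUniformRapidDecayOn_Icc hfs hT
  obtain ⟨G, hG0, hG⟩ := exists_norm_clayProjForce_le hT hfT hdT
  obtain ⟨G₂, hG₂, hg2⟩ := exists_eLpNorm_two_clayProjForce_le hT hfT hdT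
  have hgc := continuous_uncurry_clayProjForce hT hfT hdT
  -- ### the threshold `δ₀`: `δ ≤ δ₀ ⇒ δ^{3/2} ν^{3/(2q)} G ≤ C`
  set L : ℝ := ν ^ (3 / (2 * q)) * G with hL
  have hL0 : 0 ≤ L := by positivity
  set δ₀ : ℝ := min T ((C / (L + 1)) ^ (2 / 3 : ℝ)) with hδ₀
  have hδ₀pos : 0 < δ₀ := lt_min hT (Real.rpow_pos_of_pos (by positivity) _)
  have hδ₀T : δ₀ ≤ T := min_le_left _ _
  have habsorb : ∀ δ, 0 < δ → δ ≤ δ₀ → δ ^ (3 / 2 : ℝ) * L ≤ C := by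
    intro δ hδ hδle
    have h1 : δ ^ (3 / 2 : ℝ) ≤ C / (L + 1) := by
      have h2 : δ ≤ (C / (L + 1)) ^ (2 / 3 : ℝ) := hδle.trans (min_le_right _ _)
      calc δ ^ (3 / 2 : ℝ) ≤ ((C / (L + 1)) ^ (2 / 3 : ℝ)) ^ (3 / 2 : ℝ) :=
            Real.rpow_le_rpow hδ.le h2 (by norm_num)
        _ = C / (L + 1) := by
            rw [← Real.rpow_mul (by positivity)]; norm_num
    calc δ ^ (3 / 2 : ℝ) * L ≤ C / (L + 1) * L := by gcongr
      _ ≤ C / (L + 1) * (L + 1) := by gcongr; linarith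
      _ = C := div_mul_cancel₀ _ (by positivity)
  -- ### the liminf: test every `t₀ ∈ (T - δ₀, T)`
  refine Filter.le_liminf_of_le (by isBoundedDefault) ?_
  filter_upwards [Ioo_mem_nhdsLT (show T - δ₀ < T by linarith)] with t₀ ht₀
  by_contra hlt
  push Not at hlt
  set δ : ℝ := T - t₀ with hδdef
  have hδ : 0 < δ := by rw [hδdef]; linarith [ht₀.2]
  have hδδ₀ : δ ≤ δ₀ := by rw [hδdef]; linarith [ht₀.1]
  have ht₀0 : 0 < t₀ := by linarith [ht₀.1]
  -- the `L^q` bound at `t₀`: `‖u(t₀)‖_q ≤ N := C δ^{-b}`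
  set N : ℝ := C * δ ^ (-b) with hN
  have hNpos : 0 < N := by positivity
  have hNr : eLpNorm (u t₀) (ENNReal.ofReal q) volume ≤ ENNReal.ofReal N :=
    ForcedLerayRate.eLpNorm_le_of_mul_lt hδ hlt
  -- ### (R1) `u` is bounded on `[0, t₀ + δ/2]` (Sobolev bounds on a closed sub-slab)
  set T₁ : ℝ := t₀ + δ / 2 with hT₁
  have hT₁I : T₁ ∈ Ioo 0 T := ⟨by positivity, by linarith [hT₁, hδdef]⟩
  have hC2 : ∀ t ∈ Icc 0 T₁, ContDiff ℝ 2 (u t) := fun t ht =>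
    (hmax.1.contDiff_velocity ⟨ht.1, ht.2.trans_lt hT₁I.2⟩).of_le (by norm_cast)
  obtain ⟨M₁, hM₁⟩ := linfty_bound_of_hasBoundedSobolevNormsOn_holds hC2 (hTao T₁ hT₁I)
  -- ### (R2) `u` is bounded on `[t₀ + δ/2, T)`: the short-time bound from `t₀`
  have hR2 : ∀ t ∈ Ico T₁ T, ∀ x, ‖u t x‖ ≤ 4 * N * (ν * (δ / 2)) ^ (-(3 / (2 * q))) := by
    intro t ht x
    set s : ℝ := t - t₀ with hs
    have hsδ2 : δ / 2 ≤ s := by linarith [ht.1, hT₁, hs]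
    have hsδ : s < δ := by linarith [ht.2, hs, hδdef]
    have hs0 : 0 < s := by linarith
    set S : ℝ := (s + δ) / 2 with hSdef
    have hsS : s < S := by rw [hSdef]; linarith
    have hSδ : S < δ := by rw [hSdef]; linarith
    have hS0 : 0 < S := hs0.trans hsS
    set T' : ℝ := t₀ + S with hT'
    have hT'T : T' < T := by linarith [hT', hδdef, hSδ]
    have hT'0 : 0 < T' := by positivity
    -- classical on `[0, T']` with the projected force, translated to `[0, S]`
    have hclT' : IsClassicalNSSolutionOn (Icc 0 T') ν f u p :=
      hmax.1.mono (Icc_subset_Ico_right hT'T) (uniqueDiffOn_Icc hT'0)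
    have hproj := hclT'.to_clayProjForce_of_subset hT hfT hdT (Icc_subset_Icc_right hT'T.le)
    have hclS := (hproj.comp_add_right t₀).mono
      (fun r hr => show r + t₀ ∈ Icc 0 T' from ⟨by linarith [hr.1], by linarith [hr.2, hT']⟩)
      (uniqueDiffOn_Icc hS0)
    -- the force hypotheses on `[0, S]` (uniform constants from `[0, T]`)
    have hgcS : Continuous (uncurry fun r => clayProjForce hT hfT hdT (r + t₀)) := by
      have heq : (uncurry fun r => clayProjForce hT hfT hdT (r + t₀)) =
          uncurry (clayProjForce hT hfT hdT) ∘
            fun z : ℝ × EuclideanSpace ℝ (Fin 3) => (z.1 + t₀, z.2) := by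
        funext z; simp only [uncurry, Function.comp_apply]
      rw [heq]
      exact hgc.comp ((continuous_fst.add continuous_const).prodMk continuous_snd)
    have hGS : ∀ τ ∈ Icc 0 S, ∀ y, ‖(fun r => clayProjForce hT hfT hdT (r + t₀)) τ y‖ ≤ G :=
      fun τ _ y => hG _ _
    have hdivS : ∀ τ ∈ Icc 0 S, IsWeaklyDivFree ((fun r => clayProjForce hT hfT hdT (r + t₀)) τ) :=
      fun τ _ => isWeaklyDivFree_clayProjForce hT hfT hdT _
    have hg2S : ∀ τ ∈ Icc 0 S,
        eLpNorm ((fun r => clayProjForce hT hfT hdT (r + t₀)) τ) 2 volume ≤ G₂ :=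
      fun τ _ => hg2 _
    have hES : ∃ C' : ℝ≥0∞, C' < ⊤ ∧ ∀ r ∈ Icc 0 S,
        ∫⁻ x, ‖(fun r => u (r + t₀)) r x‖ₑ ^ 2 ≤ C' := by
      obtain ⟨C', hC't, hC'⟩ := hE T' ⟨hT'0, hT'T⟩
      exact ⟨C', hC't, fun r hr => hC' (r + t₀) ⟨by linarith [hr.1], by linarith [hr.2, hT']⟩⟩
    -- a sup bound on `[0, T']` (Sobolev), for the qualitative hypothesis `|u| ≤ M`
    have hC2' : ∀ t ∈ Icc 0 T', ContDiff ℝ 2 (u t) := fun t ht =>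
      (hclT'.contDiff_velocity ht).of_le (by norm_cast)
    obtain ⟨M', hM'⟩ := linfty_bound_of_hasBoundedSobolevNormsOn_holds hC2' (hTao T' ⟨hT'0, hT'T⟩)
    set M : ℝ := max M' 1 with hM
    have hMpos : 0 < M := lt_max_of_lt_right one_pos
    have hMb : ∀ r ∈ Icc 0 S, ∀ y, ‖(fun r => u (r + t₀)) r y‖ ≤ M := fun r hr y =>
      (hM' (r + t₀) ⟨by linarith [hr.1], by linarith [hr.2, hT']⟩ y).trans (le_max_left _ _)
    have hNr' : eLpNorm ((fun r => u (r + t₀)) 0) (ENNReal.ofReal q) volume ≤ ENNReal.ofReal N := by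
      simp only [zero_add]; exact hNr
    -- the window is `δ` and the force is absorbed on it
    have hsI : s ∈ Ioc 0 S := ⟨hs0, hsS.le⟩
    have hwin : s ≤ c * ν ^ ((q + 3) / (q - 3)) * (2 * N) ^ (-(2 * q / (q - 3))) := by
      rw [hN, hC, hb, ForcedLerayRate.window_eq hc hν hδ hq]; exact hsδ.le
    have habs : s ^ (1 + 3 / (2 * q)) * ν ^ (3 / (2 * q)) * G ≤ N := by
      rw [hN, hb]
      exact ForcedLerayRate.absorb_le hν hδ hq hG0 ⟨hs0, hsδ.le⟩ (habsorb δ hδ hδδ₀)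
    have hbound := hD1 hν hS0 hclS hgcS hGS hdivS hG₂ hg2S hES hMpos hMb hNpos hNr' hsI hwin habs x
    have hst : s + t₀ = t := by rw [hs]; ring
    simp only [hst] at hbound
    refine hbound.trans (mul_le_mul_of_nonneg_left ?_ (by positivity))
    exact Real.rpow_le_rpow_of_nonpos (by positivity) (by nlinarith) (by
      have : 0 < 3 / (2 * q) := by positivity
      linarith)
  -- ### the velocity is bounded up to `T`
  have hKall : ∀ t ∈ Ico 0 T, ∀ x,
      ‖u t x‖ ≤ max M₁ (4 * N * (ν * (δ / 2)) ^ (-(3 / (2 * q)))) := by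
    intro t ht x
    by_cases htc : t ≤ T₁
    · exact (hM₁ t ⟨ht.1, htc⟩ x).trans (le_max_left _ _)
    · exact (hR2 t ⟨(not_le.1 htc).le, ht.2⟩ x).trans (le_max_right _ _)
  -- ### enstrophy bounded up to `T`, extension past `T`, contradiction with maximality
  obtain ⟨B, hB⟩ := ForcedEnstrophyOfSupNorm.exists_enstrophy_le_of_norm_le_forced hν hT hmax.1
    hTao hfs hfd hKall
  exact hmax.2 (lemarieRieusset2016_H1_continuation_forced_holds hν hT hmax.1 hTao hTao' hE hu₀
    hfs hfd ⟨B, hB⟩)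

end Literature.Analysis.FluidPDE

end
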